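import Literature.MathematicalPhysics.QuantumLattice.HubbardUVWeightJets
import Literature.MathematicalPhysics.QuantumLattice.HubbardUVSymbolSmooth
import HarnessLib

/-!
# The GEOMETRIC everywhere-envelope of the band jets of the ultraviolet WEIGHT: `‖∂_eⁿ w(ω, e)‖ ≤ X·n!·(4/Λ)ⁿ` at EVERY band value

Topic `MathematicalPhysics/QuantumLattice`; sequel of `HubbardUVWeightJets` (`norm_iteratedFDeriv_uvWeightFn_band_le`: `n!·X·(2|e|/Λ²+2/Λ)ⁿ` everywhere,
`…_of_abs_le`: `n!·X·(4/Λ)ⁿ` for `|e| ≤ Λ`).  Above the shell (`Λ² < ω² + e²`) the weight is identically `1` near `e`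
(`uvWeightFn_eq_one_of_gt`), so every jet of positive order VANISHES there; together with the shell bound this gives one geometric envelope uniform in the
band — the weight factor of the resummed ultraviolet symbol in the sup/aliasing route of the K3 two-leg reading (cell gate-hubbard-kl, stub (C) «(C)-B-REP»,
memo SUP-ROUTE-SPEC §2(c)/S-c2):

* `uvWeightFn_band_eventuallyEq_one_of_gt`, `iteratedFDeriv_uvWeightFn_band_eq_zero_of_gt` (`1 ≤ n`);
* **`norm_iteratedFDeriv_uvWeightFn_band_le_geometric`** — `‖∂ⁿ w(ω,·)(e)‖ ≤ n!·X·(4/Λ)ⁿ` for EVERY `e` (`0 < Λ`, cutoff table `‖χ₂^{(l)}‖ ≤ X`, `l ≤ n`).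

Everything is proved; no definitions; no named facts.

## Sources

G. Benfatto, A. Giuliani, V. Mastropietro, Ann. Henri Poincaré 7 (2006) 809–898, §2.2 (2.36aa) [`BenfattoGiulianiMastropietro2006`];
M. Salmhofer, *Renormalization* (Springer 1999), §4.2.5 (4.71) [`Salmhofer1999`].
-/

noncomputable section

namespace Literature.MathematicalPhysics.QuantumLattice

open Finset

variable {Λ ω : ℝ}

/-- **Above the shell the weight is identically one near `e`**: `Λ² < ω² + e² ⟹ w(ω,·) =ᶠ[𝓝 e] 1`. [cite: Salmhofer1999, §4.2.5 (4.71)] -/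
theorem uvWeightFn_band_eventuallyEq_one_of_gt (hΛ : 0 < Λ) {e : ℝ} (h : Λ ^ 2 < ω ^ 2 + e ^ 2) :
    (fun t : ℝ => uvWeightFn Λ ω t) =ᶠ[nhds e] fun _ => (1 : ℝ) := by
  have hlt : Λ ^ 2 < e ^ 2 + ω ^ 2 := by linarith
  have hopen : ∀ᶠ t in nhds e, Λ ^ 2 < t ^ 2 + ω ^ 2 :=
    (continuous_pow 2 |>.add continuous_const).continuousAt.eventually (lt_mem_nhds hlt)
  filter_upwards [hopen] with t ht
  exact (uvWeightFn_eq_one_of_gt hΛ (e := ω) (ω := t) (by linarith)).1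

/-- Above the shell every band jet of positive order of the weight vanishes. [cite: Salmhofer1999, §4.2.5 (4.71)] -/
theorem iteratedFDeriv_uvWeightFn_band_eq_zero_of_gt (hΛ : 0 < Λ) {e : ℝ} (h : Λ ^ 2 < ω ^ 2 + e ^ 2) {n : ℕ} (hn : 1 ≤ n) :
    iteratedFDeriv ℝ n (fun t : ℝ => uvWeightFn Λ ω t) e = 0 := by
  rw [((uvWeightFn_band_eventuallyEq_one_of_gt hΛ h).iteratedFDeriv ℝ n).eq_of_nhds, iteratedFDeriv_const_of_ne (by omega)]
  rfl

/-- **THE GEOMETRIC EVERYWHERE-ENVELOPE OF THE WEIGHT JETS**: `‖∂ⁿ w(ω,·)(e)‖ ≤ n!·X·(4/Λ)ⁿ` at EVERY `e` (`0 < Λ`, cutoff table `‖χ₂^{(l)}‖ ≤ X`,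
`l ≤ n`): on `|e| ≤ Λ` this is `…_of_abs_le`; for `|e| > Λ` the point is above the shell, where the order-`0` value is `≤ 1 ≤ X` and higher jets vanish.
[cite: BenfattoGiulianiMastropietro2006, §2.2 (2.36aa)] -/
theorem norm_iteratedFDeriv_uvWeightFn_band_le_geometric (hΛ : 0 < Λ) (ω : ℝ) {n : ℕ} {X : ℝ}
    (hX : ∀ l ≤ n, ∀ x : ℝ, ‖iteratedFDeriv ℝ l salmhoferCutoff x‖ ≤ X) (e : ℝ) :
    ‖iteratedFDeriv ℝ n (fun t : ℝ => uvWeightFn Λ ω t) e‖ ≤ n.factorial * X * (4 / Λ) ^ n := by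
  by_cases he : |e| ≤ Λ
  · exact norm_iteratedFDeriv_uvWeightFn_band_le_of_abs_le hΛ ω hX he
  · have hgt : Λ ^ 2 < ω ^ 2 + e ^ 2 := by
      have h1 : Λ < |e| := not_le.1 he
      have h2 : Λ ^ 2 < |e| ^ 2 := by gcongr
      rw [sq_abs] at h2
      nlinarith [sq_nonneg ω]
    rcases Nat.eq_zero_or_pos n with hn | hn
    · subst hn
      -- order 0: the value of the cutoff, bounded by the table at `l = 0`
      rw [norm_iteratedFDeriv_zero]
      have h0 := hX 0 le_rfl ((e ^ 2 + ω ^ 2) / Λ ^ 2)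
      rw [norm_iteratedFDeriv_zero] at h0
      simpa [uvWeightFn_band_eq] using h0
    · rw [iteratedFDeriv_uvWeightFn_band_eq_zero_of_gt hΛ hgt hn, norm_zero]
      have hX0 : 0 ≤ X := (norm_nonneg _).trans (hX 0 (Nat.zero_le _) 0)
      positivity

end Literature.MathematicalPhysics.QuantumLattice

end
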